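import Summits.CriticalPhenomena.Ising3DConformalLimit.Theses.MonotoneBlocking
import HarnessLib

/-!
# Vocabulary of line `Sketch` (idea `karlin-scale-tp2`) for crux `MonotoneBlockingTwo` (stmt-CriticalPhenomena-17054)

Route `MonotoneBlocking` (sub-problem `CriticalPhenomena/Ising3DConformalLimit`), crux
`Summit.CriticalPhenomena.Ising3DConformalLimit.Theses.MonotoneBlocking.MonotoneBlockingTwo` (BM₂, item
stmt-CriticalPhenomena-17054): for all `L ≥ 1` and all `k ∈ ℤ³`,
`bc(L,k) · bc(L+1,0) ≤ bc(L+1,k) · bc(L,0)` with `bc(L,k) = Σ_{x,y ∈ [0,L)³} ⟨σ₀ σ_{Lk+x−y}⟩_{β_c(3)}`.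

This file is the **definitions module** of the lead's skeleton `Cruxes/MonotoneBlockingTwo/Lines/Sketch.lean`
(lead `prover-line-stmt-CriticalPhenomena-17054-0`; the planner's sketch is `Cruxes/MonotoneBlockingTwo/SketchIdeator1R1.lean`,
idea card `Cruxes/MonotoneBlockingTwo/Ideas/karlin-scale-tp2.md`). It carries, sorry-free, the line's VOCABULARY —
the route's cube and block-covariance functional `bcK` for an arbitrary lattice kernel, the BM₂ shape `BM2Shape`
(the crux is `BM2Shape (criticalTwoPoint 3)` by `Iff.rfl`), the unit tent and its fold, the cell-smearing
`cellSmear Γ` of a continuum kernel `Γ : ℝ³ → ℝ` (written curried, `ℝ → ℝ → ℝ → ℝ`, all integrals NESTED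
one-dimensional Lebesgue integrals in `ℝ≥0∞`, so that no product-measure Fubini on `Fin 3 → ℝ` is ever needed),
the scaled block integrals `blockIntegral` / `foldedBlockIntegral`, the scale-total-positivity class
`KarlinClass`, the two halves of the line `KarlinComposition` (provable) and `CriticalKarlinRepresentable`
(the transferred crux), and the seven registered stub STATEMENTS `Sig.stub_*` (each a `def … : Prop` to be PROVED
by a helper file `Theorems/MonotoneBlockingMonotoneBlockingTwo<Stub>.lean`, `--supports stmt-CriticalPhenomena-17054`).
NOTHING in this file is asserted except the definitional bridge `monotoneBlockingTwo_iff`.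

## The line in one paragraph

Embed the lattice block covariance EXACTLY in the continuum: if `G = cellSmear Γ + N·𝟙₀` then
`Σ_{x,y ∈ cube L} G(Lk+x−y) = L⁶ ∫ T(s₁−k₁)∫ T(s₂−k₂)∫ T(s₃−k₃) Γ(Ls) + N L³ 𝟙_{k=0}` (`T` the unit tent;
stubs `convolution1D`, `blockSum_cellSmear`); fold each coordinate to `(0,∞)` by evenness (stub `fold`), where the
folded tent `T(t−n)+T(t+n)` is TP₂ in `(t,n) ∈ [0,∞) × ℕ` (stub `foldedTent_tp2`, log-concavity of the tent — true only
because tent width = block spacing); the class axiom says `(L,s) ↦ Γ(L s)` is multivariate-TP₂ on `(0,∞)⁴`, so the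
integrand `Γ(Ls) · Π S(sᵢ,nᵢ)` is MTP₂ in all seven variables `(L, n, s)`, and MTP₂ survives integrating out one totally
ordered coordinate at a time (stub `fourFunctions` = the continuous four-functions theorem on a chain, a POINTWISE
inequality integrated by Tonelli — this replaces the Holley/FKG step of the card); three marginalisations give MTP₂ of
the folded block integral in `(L, n)` (stub `foldedBlockIntegral_tp2`), which contains the BM₂ comparison
`(L,|k|) ∧ (L+1,0) = (L,0)`, `(L,|k|) ∨ (L+1,0) = (L+1,|k|)` with no division and no chaining; the nugget column is
monotone by the class axiom (cubic). The composition `KarlinComposition` is then lead's glue, and the crux follows from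
the transfer `CriticalKarlinRepresentable` (stub 7, the research half: not derivable from the tree's qualitative
knowledge of `criticalTwoPoint 3`).

## Deliberate deviations from the planner's sketch (same composition idea, same transfer)

* `Γ` is curried and all integrals are nested 1-D `lintegral`s of `ENNReal.ofReal ∘ Γ` (`cellSmear` is the `toReal`
  of `cellSmearE`); for the non-negative locally finite kernels of the class this is the sketch's Bochner double cube
  integral.
* The class is stated on the OPEN orthant and the sketch's two shape axioms (mtp2) + (scale) are merged into the one
  joint condition the proof consumes, "`(L,a,b,c) ↦ Γ(La,Lb,Lc)` is MTP₂ on `(0,∞)⁴`" (for positive kernels this is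
  equivalent to (mtp2) ∧ (scale): on a product of chains a positive kernel is MTP₂ iff it is TP₂ in every pair
  of coordinates, Karlin–Rinott 1980 §2). The sketch's (mtp2) at
  vectors with a vanishing coordinate would exclude the advertised power-law members (`Γ 0 = 0` junk value).
* (pos) is weakened to (nonneg); (int) is replaced by the consumed finiteness `cellSmearE Γ z < ∞` (automatic for
  locally integrable kernels: the tent has compact support).

Sources: S. Karlin, *Total Positivity* I (Stanford UP 1968), ch. 3 §1 (basic composition formula); S. Karlin,
Y. Rinott, J. Multivariate Anal. 10 (1980) 467–498, §2–§3 (MTP₂, the four-function form, pairwise criterion,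
marginals);
R. Ahlswede, D. Daykin, Z. Wahrsch. 43 (1978) 183 (four functions); A. Khare, *Matrix Analysis and Entrywise
Positivity Preservers* (CUP 2022), Cor. 4.13; idea card `karlin-scale-tp2` (this crux).
-/

noncomputable section

namespace Summit.CriticalPhenomena.Ising3DConformalLimit.Cruxes.MonotoneBlockingTwo.KarlinScaleTP2

open MeasureTheory Set
open scoped BigOperators ENNReal
open Literature.Probability.LatticeModels
open Summit.CriticalPhenomena.Ising3DConformalLimit.Theses.MonotoneBlocking (MonotoneBlockingTwo)

/-! ## §0 The BM₂ shape of an arbitrary lattice kernel (the route's let-bound `cube`, `bc`, verbatim) -/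

/-- The route's cube `[0,L)³ ∩ ℤ³` (`cube 0 = ∅`). -/
def cube (L : ℕ) : Finset (Site 3) := Fintype.piFinset fun _ : Fin 3 => Finset.Ico (0:ℤ) (L:ℤ)

/-- Block-covariance functional of a lattice kernel `G`: `bc_G(L,k) = Σ_{x,y ∈ cube L} G(L•k + x − y)`. -/
def bcK (G : Site 3 → ℝ) (L : ℕ) (k : Site 3) : ℝ :=
  ∑ x ∈ cube L, ∑ y ∈ cube L, G ((L:ℤ) • k + x - y)

/-- The BM₂ shape of a lattice kernel `G`: `ρ_G(L;k) = bc(L,k)/bc(L,0)` is non-decreasing in `L ≥ 1`,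
cross-multiplied (no division): `bc(L,k)·bc(L+1,0) ≤ bc(L+1,k)·bc(L,0)`. -/
def BM2Shape (G : Site 3 → ℝ) : Prop :=
  ∀ L : ℕ, 1 ≤ L → ∀ k : Site 3, bcK G L k * bcK G (L+1) 0 ≤ bcK G (L+1) k * bcK G L 0

/-- The crux IS the BM₂ shape of the critical two-point function of the n.n. Ising model on `ℤ³` (definitional). -/
theorem monotoneBlockingTwo_iff : MonotoneBlockingTwo ↔ BM2Shape (criticalTwoPoint 3) := Iff.rfl

/-! ## §1 Tents -/

/-- The unit tent `T(u) = (1 − |u|)₊`, the density of `U − V` for `U, V` independent uniform on `[0,1)`. -/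
def tent (u : ℝ) : ℝ := max 0 (1 - |u|)

/-- The folded tent `S(t,n) = T(t − n) + T(t + n)` (`t ≥ 0`, `n ∈ ℕ`): `S(t,0) = 2T(t)` and `S(t,n) = T(t−n)` for
`n ≥ 1`, `t ≥ 0`. It is TP₂ on `[0,∞) × ℕ` (stub `foldedTent_tp2`). -/
def foldedTent (t : ℝ) (n : ℕ) : ℝ := tent (t - n) + tent (t + n)

/-! ## §2 Continuum kernels: cell-smearing and scaled block integrals (nested 1-D Lebesgue integrals in `ℝ≥0∞`) -/

/-- Cell-smearing of a continuum kernel `Γ : ℝ³ → ℝ` (curried) onto `ℤ³`, in `ℝ≥0∞`: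
`(Γ⋆T)(z) = ∫_{[0,1)⁶} Γ(z + u − v) du dv`, written as six nested one-dimensional integrals in the order
`u₁ v₁ u₂ v₂ u₃ v₃` (coordinate by coordinate). -/
def cellSmearE (Γ : ℝ → ℝ → ℝ → ℝ) (z : Site 3) : ℝ≥0∞ :=
  ∫⁻ u₁ in Ico (0:ℝ) 1, ∫⁻ v₁ in Ico (0:ℝ) 1, ∫⁻ u₂ in Ico (0:ℝ) 1, ∫⁻ v₂ in Ico (0:ℝ) 1,
    ∫⁻ u₃ in Ico (0:ℝ) 1, ∫⁻ v₃ in Ico (0:ℝ) 1,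
      ENNReal.ofReal (Γ (((z 0 : ℤ) : ℝ) + u₁ - v₁) (((z 1 : ℤ) : ℝ) + u₂ - v₂) (((z 2 : ℤ) : ℝ) + u₃ - v₃))

/-- Cell-smearing as a real number (the lattice kernel represented by `Γ`). -/
def cellSmear (Γ : ℝ → ℝ → ℝ → ℝ) (z : Site 3) : ℝ := (cellSmearE Γ z).toReal

/-- The scaled block integral `∫ T(s₁−k₀) ∫ T(s₂−k₁) ∫ T(s₃−k₂) Γ(L s₁, L s₂, L s₃) ds₃ ds₂ ds₁` over `ℝ³`
(nested, `ℝ≥0∞`): `L⁶ ·` this is the block sum `Σ_{x,y ∈ cube L} (Γ⋆T)(L•k + x − y)` (stub `blockSum_cellSmear`). -/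
def blockIntegral (Γ : ℝ → ℝ → ℝ → ℝ) (L : ℝ) (k : Site 3) : ℝ≥0∞ :=
  ∫⁻ s₁, ENNReal.ofReal (tent (s₁ - ((k 0 : ℤ) : ℝ))) *
    ∫⁻ s₂, ENNReal.ofReal (tent (s₂ - ((k 1 : ℤ) : ℝ))) *
      ∫⁻ s₃, ENNReal.ofReal (tent (s₃ - ((k 2 : ℤ) : ℝ))) * ENNReal.ofReal (Γ (L * s₁) (L * s₂) (L * s₃))

/-- The folded scaled block integral over the open orthant, with non-negative integer offsets:
`∫_{(0,∞)} S(s₁,n₀) ∫_{(0,∞)} S(s₂,n₁) ∫_{(0,∞)} S(s₃,n₂) Γ(L s₁, L s₂, L s₃)` (nested, `ℝ≥0∞`). For a kernel even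
in each coordinate it equals `blockIntegral Γ L k` at `n = |k|` (stub `fold`). -/
def foldedBlockIntegral (Γ : ℝ → ℝ → ℝ → ℝ) (L : ℝ) (n : Fin 3 → ℕ) : ℝ≥0∞ :=
  ∫⁻ s₁ in Ioi (0:ℝ), ENNReal.ofReal (foldedTent s₁ (n 0)) *
    ∫⁻ s₂ in Ioi (0:ℝ), ENNReal.ofReal (foldedTent s₂ (n 1)) *
      ∫⁻ s₃ in Ioi (0:ℝ), ENNReal.ofReal (foldedTent s₃ (n 2)) * ENNReal.ofReal (Γ (L * s₁) (L * s₂) (L * s₃))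

/-! ## §3 The scale-total-positivity (Karlin) class -/

/-- **The scale-total-positivity class 𝒦** of continuum kernels `Γ : ℝ³ → ℝ` (curried), in the form the
composition argument consumes:
* `measurable`, `nonneg`;
* `even₁₂₃` — invariance under each coordinate reflection (so that block sums fold to the open orthant);
* `mtp2` — the map `(L,a,b,c) ↦ Γ(La,Lb,Lc)` is multivariate totally positive of order 2 on `(0,∞)⁴`
  (coordinatewise `max`/`min`): for positive kernels this is the conjunction of the card's (mtp2) "`Γ∘|·|` is MTP₂
  in the magnitudes" and (scale) "the dilation ratio `Γ(λy)/Γ(y)`, `λ ≥ 1`, is non-decreasing in the magnitudes"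
  (local scaling exponent non-increasing; exact power laws `|y|^{-a}` satisfy it, with equality in the scale
  direction; `|y|^{-a}(1 + d|y|^{-ω})` satisfies it iff `d ≥ 0`);
* `cubic` — `Γ(y) ≤ λ³ Γ(λy)` for `λ ≥ 1` (decay no faster than `|y|⁻³`; only the nugget column uses it);
* `smearFinite` — every cell-smeared value is finite (automatic for locally integrable kernels). -/
structure KarlinClass (Γ : ℝ → ℝ → ℝ → ℝ) : Prop where
  measurable : Measurable fun p : ℝ × ℝ × ℝ => Γ p.1 p.2.1 p.2.2
  nonneg : ∀ a b c : ℝ, 0 ≤ Γ a b c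
  even₁ : ∀ a b c : ℝ, Γ (-a) b c = Γ a b c
  even₂ : ∀ a b c : ℝ, Γ a (-b) c = Γ a b c
  even₃ : ∀ a b c : ℝ, Γ a b (-c) = Γ a b c
  mtp2 : ∀ L L' a b c a' b' c' : ℝ, 0 < L → 0 < L' → 0 < a → 0 < b → 0 < c → 0 < a' → 0 < b' → 0 < c' →
    Γ (L * a) (L * b) (L * c) * Γ (L' * a') (L' * b') (L' * c') ≤
      Γ (max L L' * max a a') (max L L' * max b b') (max L L' * max c c') *
        Γ (min L L' * min a a') (min L L' * min b b') (min L L' * min c c')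
  cubic : ∀ lam : ℝ, 1 ≤ lam → ∀ a b c : ℝ, Γ a b c ≤ lam ^ 3 * Γ (lam * a) (lam * b) (lam * c)
  smearFinite : ∀ z : Site 3, cellSmearE Γ z < ∞

/-! ## §4 The two halves of the line -/

/-- **KarlinComposition** (the provable half; lead's glue over stubs 1–6): for `Γ ∈ 𝒦` and a nugget `N ≥ 0` the
lattice kernel `z ↦ (Γ⋆T)(z) + N·𝟙_{z=0}` has the BM₂ shape for all `L ≥ 1` and all offsets `k`. -/
def KarlinComposition : Prop :=
  ∀ (Γ : ℝ → ℝ → ℝ → ℝ) (N : ℝ), KarlinClass Γ → 0 ≤ N →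
    BM2Shape (fun z => cellSmear Γ z + if z = 0 then N else 0)

/-- **C⁺ = CriticalKarlinRepresentable** (the transferred crux; stub 7): the critical two-point function of the
nearest-neighbour Ising model on `ℤ³` is the cell-smearing of a kernel of the class plus a non-negative on-site
nugget. Contains the infrared bit of BM₂ (sign `d ≥ 0` of the leading correction to scaling, as `mtp2` in the scale
direction at large `|y|`) and an ultraviolet feasibility statement; implies BM₂ by `KarlinComposition`. -/
def CriticalKarlinRepresentable : Prop :=
  ∃ (Γ : ℝ → ℝ → ℝ → ℝ) (N : ℝ), KarlinClass Γ ∧ 0 ≤ N ∧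
    ∀ z : Site 3, criticalTwoPoint 3 z = cellSmear Γ z + if z = 0 then N else 0

/-- The stronger conclusion the composition argument delivers (testable prediction): TP₂ of `bc` in
(block side, coordinatewise offset magnitude). -/
def BlockTP2 (G : Site 3 → ℝ) : Prop :=
  ∀ L L' : ℕ, 1 ≤ L → L ≤ L' → ∀ k k' : Site 3, (∀ i, |k i| ≤ |k' i|) →
    bcK G L k' * bcK G L' k ≤ bcK G L k * bcK G L' k'

/-! ## §5 Registered stub statements (nothing asserted) -/

/-- STUB 1 statement — the continuous four-functions theorem on a chain (Ahlswede–Daykin / Karlin–Rinott in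
dimension one, for an arbitrary s-finite measure on `ℝ` restricted to a measurable set): if
`f₁(t) f₂(t') ≤ f₃(t ∨ t') f₄(t ∧ t')` on `S × S` then `∫_S f₁ · ∫_S f₂ ≤ ∫_S f₃ · ∫_S f₄`. (Proof route: the
hypothesis at the four pairs `(t,t'), (t',t), (t,t), (t',t')` gives the POINTWISE inequality
`f₁ t f₂ t' + f₁ t' f₂ t ≤ f₃ t f₄ t' + f₃ t' f₄ t`; integrate over `S × S` by Tonelli.) -/
def Sig.stub_fourFunctions : Prop :=
  ∀ (μ : Measure ℝ) [SFinite μ] (S : Set ℝ), MeasurableSet S →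
    ∀ (f₁ f₂ f₃ f₄ : ℝ → ℝ≥0∞), Measurable f₁ → Measurable f₂ → Measurable f₃ → Measurable f₄ →
      (∀ t ∈ S, ∀ t' ∈ S, f₁ t * f₂ t' ≤ f₃ (max t t') * f₄ (min t t')) →
        (∫⁻ t in S, f₁ t ∂μ) * (∫⁻ t in S, f₂ t ∂μ) ≤ (∫⁻ t in S, f₃ t ∂μ) * (∫⁻ t in S, f₄ t ∂μ)

/-- STUB 2 statement — the folded unit tent is TP₂ on `[0,∞) × ℕ`:
`S(t,n) S(t',n') ≤ S(t ∨ t', n ∨ n') S(t ∧ t', n ∧ n')` (log-concavity of the tent; tent width = block spacing). -/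
def Sig.stub_foldedTent_tp2 : Prop :=
  ∀ (t t' : ℝ) (n n' : ℕ), 0 ≤ t → 0 ≤ t' →
    foldedTent t n * foldedTent t' n' ≤ foldedTent (max t t') (max n n') * foldedTent (min t t') (min n n')

/-- STUB 3 statement — the engine: for `Γ ∈ 𝒦` the folded scaled block integral is MTP₂ in
`(L, n) ∈ (0,∞) × ℕ³` (three marginalisations of the MTP₂ integrand `Γ(Ls)·Π S(sᵢ,nᵢ)`, each by stub 1; the
tent factor by stub 2). -/
def Sig.stub_foldedBlockIntegral_tp2 : Prop :=
  Sig.stub_fourFunctions → Sig.stub_foldedTent_tp2 →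
    ∀ Γ : ℝ → ℝ → ℝ → ℝ, KarlinClass Γ →
      ∀ (L L' : ℝ) (n n' : Fin 3 → ℕ), 0 < L → 0 < L' →
        foldedBlockIntegral Γ L n * foldedBlockIntegral Γ L' n' ≤
          foldedBlockIntegral Γ (max L L') (n ⊔ n') * foldedBlockIntegral Γ (min L L') (n ⊓ n')

/-- STUB 4 statement — the one-dimensional lattice→continuum convolution identity: for measurable
`φ : ℝ → ℝ≥0∞`, `L ≥ 1` and `κ ∈ ℤ`,
`Σ_{x,y ∈ [0,L)} ∫_{[0,1)}∫_{[0,1)} φ(Lκ + x + u − y − v) du dv = L² ∫ T(s − κ) φ(Ls) ds`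
(the double cube sum of unit-cell averages is the integral over `[0,L)²`; `X − Y` has density `(L − |D|)₊ = L·T(D/L)`). -/
def Sig.stub_convolution1D : Prop :=
  ∀ (φ : ℝ → ℝ≥0∞), Measurable φ → ∀ (L : ℕ), 1 ≤ L → ∀ (κ : ℤ),
    ∑ x ∈ Finset.Ico (0:ℤ) L, ∑ y ∈ Finset.Ico (0:ℤ) L,
        ∫⁻ u in Ico (0:ℝ) 1, ∫⁻ v in Ico (0:ℝ) 1, φ ((L:ℝ) * (κ:ℝ) + (x:ℝ) + u - (y:ℝ) - v) =
      ((L:ℝ≥0∞) ^ 2) * ∫⁻ s, ENNReal.ofReal (tent (s - (κ:ℝ))) * φ ((L:ℝ) * s)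

/-- STUB 5 statement — the exact continuum embedding of the block sum (stub 4 iterated over the three
coordinates): `Σ_{x,y ∈ cube L} (Γ⋆T)(L•k + x − y) = L⁶ · blockIntegral Γ L k` for measurable `Γ`. -/
def Sig.stub_blockSum_cellSmear : Prop :=
  Sig.stub_convolution1D →
    ∀ Γ : ℝ → ℝ → ℝ → ℝ, (Measurable fun p : ℝ × ℝ × ℝ => Γ p.1 p.2.1 p.2.2) →
      ∀ (L : ℕ), 1 ≤ L → ∀ k : Site 3,
        ∑ x ∈ cube L, ∑ y ∈ cube L, cellSmearE Γ ((L:ℤ) • k + x - y) =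
          ((L:ℝ≥0∞) ^ 6) * blockIntegral Γ (L:ℝ) k

/-- STUB 6 statement — folding to the open orthant: for `Γ ∈ 𝒦` (even in each coordinate) and `L > 0`,
`blockIntegral Γ L k = foldedBlockIntegral Γ L |k|` (coordinatewise `natAbs`). -/
def Sig.stub_fold : Prop :=
  ∀ Γ : ℝ → ℝ → ℝ → ℝ, KarlinClass Γ → ∀ (L : ℝ), 0 < L → ∀ k : Site 3,
    blockIntegral Γ L k = foldedBlockIntegral Γ L (fun i => (k i).natAbs)

/-- STUB 7 statement — the transferred crux `CriticalKarlinRepresentable` (research stub; see its docstring). -/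
def Sig.stub_criticalKarlinRepresentable : Prop := CriticalKarlinRepresentable

end Summit.CriticalPhenomena.Ising3DConformalLimit.Cruxes.MonotoneBlockingTwo.KarlinScaleTP2

end
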